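import Summits.QuantumFields.QCD.Theorems.QuarksAsStableActionStableActionBridgeSoftClosureTensor

/-!
# `stub_spatialClustering` (crux stmt-QuantumFields-11525 `ConvergentOSClosure`, line birth) — wave-2 re-check

Verdict support file (NOT a proof of the stub).  What the new hypothesis P2 (k-uniform E0′ bound) buys, exactly:
together with P3′ (convergence on off-diagonal real tensors) it makes the canonical lattice distributions
`qcdLatticeDist sch k` converge on all of `⁰𝒮` to ONE labelled family `S` (landed:
`tendsto_qcdLatticeDist_of_tensor`, `stub_offDiagonalTensorDensity`, `exists_labelled_tendsto`), and along such a
convergent sequence the conclusion P9 of the stub is EQUIVALENT to the OS cluster property E4 of the limit `S`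
(`clustersSpatiallySeq_iff_hasClusterProperty`, proved below; `⇒` is the tree's
`hasClusterProperty_of_labelled_tendsto`, `⇐` uses uniqueness of append-tensor witnesses).  So P2 turns the stub into
"crux hypotheses ⇒ E4 of the continuum limit", no more and no less (`stub_spatialClustering_iff_limit_clusters`);
the per-pair lattice gap `HasLatticeMassGap` remains the only `Δ`-carrying hypothesis and is idle for the k-growing
family of smeared insertion patterns (wave-1 analysis §E4, defects D2/D3).

Everything here is `sorry`-free; the open goal is recorded in `stub_reflectionAxioms-analysis.md` (wave-2 addendum).
-/

noncomputable section

open Filter Topology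
open scoped SchwartzMap
open Literature.MathematicalPhysics.AQFT Literature.MathematicalPhysics.QuantumLattice
open Literature.MathematicalPhysics.QuantumFieldTheory
open Summit.QuantumFields.QCD.Cruxes.StableActionBridge.Sketch

namespace Summit.QuantumFields.QCD.Theorems.ConvergentOSClosure

section Abstract

variable {ι : Type} {d : ℕ} [NeZero d]

/-- The P9 clause of the `StableActionBridge` lattice package for a sequence of labelled families: k-uniform
spatial clustering in `ε`–`t₀` form, `t₀` chosen BEFORE `∀ᶠ k`. -/
def ClustersSpatiallySeq (Λ : ℕ → LabelledSchwingerFamily ι (EuclideanSpace ℝ (Fin d))) : Prop :=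
  ∀ (n m : ℕ) (σ : Fin n → ι) (σ' : Fin m → ι) (F : 𝓢((Fin n → EuclideanSpace ℝ (Fin d)), ℂ))
    (G : 𝓢((Fin m → EuclideanSpace ℝ (Fin d)), ℂ)), IsTimeOrdered F → IsTimeOrdered G →
    ∀ a : EuclideanSpace ℝ (Fin d), a 0 = 0 → a ≠ 0 →
    ∀ ε : ℝ, 0 < ε → ∃ t₀ : ℝ, ∀ t : ℝ, t₀ ≤ t →
      ∀ H : 𝓢((Fin (n + m) → EuclideanSpace ℝ (Fin d)), ℂ),
        IsAppendTensorOf H (osAdjoint F) (translateMulti (t • a) G) →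
        ∀ᶠ k in atTop, ‖Λ k (n + m) (Fin.append (σ ∘ Fin.rev) σ') H -
          Λ k n (σ ∘ Fin.rev) (osAdjoint F) * Λ k m σ' G‖ ≤ ε

/-- The same clause for ONE labelled family (`ε`–`t₀` form of E4). -/
def ClustersSpatiallyLim (S : LabelledSchwingerFamily ι (EuclideanSpace ℝ (Fin d))) : Prop :=
  ∀ (n m : ℕ) (σ : Fin n → ι) (σ' : Fin m → ι) (F : 𝓢((Fin n → EuclideanSpace ℝ (Fin d)), ℂ))
    (G : 𝓢((Fin m → EuclideanSpace ℝ (Fin d)), ℂ)), IsTimeOrdered F → IsTimeOrdered G →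
    ∀ a : EuclideanSpace ℝ (Fin d), a 0 = 0 → a ≠ 0 →
    ∀ ε : ℝ, 0 < ε → ∃ t₀ : ℝ, ∀ t : ℝ, t₀ ≤ t →
      ∀ H : 𝓢((Fin (n + m) → EuclideanSpace ℝ (Fin d)), ℂ),
        IsAppendTensorOf H (osAdjoint F) (translateMulti (t • a) G) →
        ‖S (n + m) (Fin.append (σ ∘ Fin.rev) σ') H - S n (σ ∘ Fin.rev) (osAdjoint F) * S m σ' G‖ ≤ ε

omit [NeZero d] in
/-- Append-tensor witnesses are unique. -/
theorem eq_of_isAppendTensorOf {n m : ℕ} {H H' : 𝓢((Fin (n + m) → EuclideanSpace ℝ (Fin d)), ℂ)}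
    {F : 𝓢((Fin n → EuclideanSpace ℝ (Fin d)), ℂ)} {G : 𝓢((Fin m → EuclideanSpace ℝ (Fin d)), ℂ)}
    (hH : IsAppendTensorOf H F G) (hH' : IsAppendTensorOf H' F G) : H = H' := by
  ext x
  rw [hH x, hH' x]

/-- `ε`–`t₀` clustering of one family is exactly the OS cluster property E4. -/
theorem clustersSpatiallyLim_iff_hasClusterProperty (S : LabelledSchwingerFamily ι (EuclideanSpace ℝ (Fin d))) :
    ClustersSpatiallyLim S ↔ S.HasClusterProperty := by
  constructor
  · intro h n m σ σ' F G hF hG a ha0 ha H hH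
    rw [Metric.tendsto_nhds]
    intro ε hε
    obtain ⟨t₀, ht₀⟩ := h n m σ σ' F G hF hG a ha0 ha (ε / 2) (half_pos hε)
    refine (eventually_ge_atTop t₀).mono fun t ht => ?_
    rw [dist_zero_right]
    exact (ht₀ t ht (H t) (hH t)).trans_lt (half_lt_self hε)
  · intro h n m σ σ' F G hF hG a ha0 ha ε hε
    -- the canonical witness family
    set H₀ : ℝ → 𝓢((Fin (n + m) → EuclideanSpace ℝ (Fin d)), ℂ) := fun t =>
      SchwartzMap.appendTensor (osAdjoint F) (translateMulti (t • a) G) with hH₀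
    have hH₀w : ∀ t, IsAppendTensorOf (H₀ t) (osAdjoint F) (translateMulti (t • a) G) := fun t =>
      isAppendTensorOf_appendTensor _ _
    have ht := h n m σ σ' F G hF hG a ha0 ha H₀ hH₀w
    rw [Metric.tendsto_nhds] at ht
    obtain ⟨t₀, ht₀⟩ := eventually_atTop.1 (ht ε hε)
    refine ⟨t₀, fun t htt H hH => ?_⟩
    have hHH : H = H₀ t := eq_of_isAppendTensorOf hH (hH₀w t)
    have := ht₀ t htt
    rw [dist_zero_right, ← hHH] at this
    exact this.le

/-- **Along a sequence convergent on `⁰𝒮`, k-uniform spatial clustering (P9) is equivalent to E4 of the limit.**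
`⇒`: the tree's `hasClusterProperty_of_labelled_tendsto`; `⇐`: the lattice truncated function at `(t, H)` converges
to the limit truncated function, which is `≤ ε/2 < ε` beyond `t₀(ε/2)`. -/
theorem clustersSpatiallySeq_iff_hasClusterProperty
    {Λ : ℕ → LabelledSchwingerFamily ι (EuclideanSpace ℝ (Fin d))}
    {S : LabelledSchwingerFamily ι (EuclideanSpace ℝ (Fin d))}
    (hconv : ∀ (n : ℕ) (σ : Fin n → ι) (F : 𝓢((Fin n → EuclideanSpace ℝ (Fin d)), ℂ)), IsOffDiagonal F →
      Tendsto (fun j => Λ j n σ F) atTop (𝓝 (S n σ F))) :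
    ClustersSpatiallySeq Λ ↔ S.HasClusterProperty := by
  constructor
  · intro h
    exact hasClusterProperty_of_labelled_tendsto hconv h
  · intro h n m σ σ' F G hF hG a ha0 ha ε hε
    rw [← clustersSpatiallyLim_iff_hasClusterProperty] at h
    obtain ⟨t₀, ht₀⟩ := h n m σ σ' F G hF hG a ha0 ha (ε / 2) (half_pos hε)
    refine ⟨t₀, fun t ht H hH => ?_⟩
    have hGt : IsTimeOrdered (translateMulti (t • a) G) :=
      OSReconstructionNoE1.isTimeOrdered_translateMulti hG (by simp [ha0])
    have hHo : IsOffDiagonal H := hH.isOffDiagonal_of_isTimeOrdered hF hGt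
    have hlim : Tendsto (fun j => Λ j (n + m) (Fin.append (σ ∘ Fin.rev) σ') H -
        Λ j n (σ ∘ Fin.rev) (osAdjoint F) * Λ j m σ' G) atTop
        (𝓝 (S (n + m) (Fin.append (σ ∘ Fin.rev) σ') H - S n (σ ∘ Fin.rev) (osAdjoint F) * S m σ' G)) :=
      (hconv _ _ _ hHo).sub ((hconv _ _ _ hF.isOffDiagonal.osAdjoint).mul (hconv _ _ _ hG.isOffDiagonal))
    have hlt : ‖S (n + m) (Fin.append (σ ∘ Fin.rev) σ') H - S n (σ ∘ Fin.rev) (osAdjoint F) * S m σ' G‖ < ε :=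
      (ht₀ t ht H hH).trans_lt (half_lt_self hε)
    exact ((hlim.norm.eventually (gt_mem_nhds hlt))).mono fun j hj => hj.le

end Abstract

/-! ### The QCD instance: what P2 reduces the stub to -/

/-- **P2 + P3′ give the limit family, and the stub's conclusion P9 is equivalent to its cluster property E4.**
For every scheme with the k-uniform E0′ bound (P2) and convergence of the honest lattice `n`-point functions on
off-diagonal real tensors (P3′), there is a labelled family `S` on `⁰𝒮` with `qcdLatticeDist sch k n σ F → S n σ F`
for all off-diagonal `F`, the E0′ bound, and `P9(qcdLatticeDist sch) ↔ S.HasClusterProperty`.  (Asymptotic scaling,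
the branch and `HasLatticeMassGap` are not used: they are the hypotheses from which E4 of `S` would have to come.) -/
theorem stub_spatialClustering_iff_limit_clusters {Nf : ℕ} (sch : QCDScheme Nf) {s : ℕ} {α β : ℝ} (hα : 0 ≤ α)
    (hbound : ∀ (n : ℕ) (σ : Fin n → QCDField Nf), ∀ᶠ k in atTop,
      ∀ F : 𝓢((Fin n → EuclideanSpace ℝ (Fin 4)), ℂ), IsOffDiagonal F →
        ‖qcdLatticeDist sch k n σ F‖ ≤ α * (n.factorial : ℝ) ^ β * schwartzNorm (n * s) F)
    (hconv : ∀ n : ℕ, n ≠ 0 → ∀ (σ : Fin n → QCDField Nf) (f : Fin n → 𝓢(EuclideanSpace ℝ (Fin 4), ℝ))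
      (F : 𝓢((Fin n → EuclideanSpace ℝ (Fin 4)), ℂ)), IsTensorOf F (fun i => ofRealTest (f i)) → IsOffDiagonal F →
      ∃ c : ℂ, Tendsto (fun k : ℕ => qcdLatticeSchwinger sch k n σ f) atTop (𝓝 c)) :
    ∃ S : LabelledSchwingerFamily (QCDField Nf) (EuclideanSpace ℝ (Fin 4)),
      (∀ (n : ℕ) (σ : Fin n → QCDField Nf) (F : 𝓢((Fin n → EuclideanSpace ℝ (Fin 4)), ℂ)), IsOffDiagonal F →
        Tendsto (fun k => qcdLatticeDist sch k n σ F) atTop (𝓝 (S n σ F))) ∧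
      (∀ (n : ℕ) (σ : Fin n → QCDField Nf) (F : 𝓢((Fin n → EuclideanSpace ℝ (Fin 4)), ℂ)),
        ‖S n σ F‖ ≤ α * (n.factorial : ℝ) ^ β * schwartzNorm (n * s) F) ∧
      (ClustersSpatiallySeq (fun k => qcdLatticeDist sch k) ↔ S.HasClusterProperty) := by
  have hconv' := tendsto_qcdLatticeDist_of_tensor sch stub_offDiagonalTensorDensity hbound hconv
  obtain ⟨S, hS, hSb⟩ := exists_labelled_tendsto (fun k => qcdLatticeDist sch k)
    (fun n => α * (n.factorial : ℝ) ^ β) (fun n => n * s) (fun n => by positivity) hbound hconv'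
  exact ⟨S, hS, hSb, clustersSpatiallySeq_iff_hasClusterProperty hS⟩

end Summit.QuantumFields.QCD.Theorems.ConvergentOSClosure

end
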